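import Summits.BirchSwinnertonDyer.Rank1Residual.P2.CongruentNumberPairsAtTwoEvenAtlasThree
import Summits.BirchSwinnertonDyer.Rank1Residual.P2.CongruentNumberPairsAtTwoLLTRedei
import Literature.NumberTheory.EllipticCurves.Tian2014.ClassFiveFamilyDescentProofs
import Literature.NumberTheory.EllipticCurves.CongruentNumberEvenMonskySelmerExact
import Literature.NumberTheory.QuadraticFields.RedeiReichardtFourRank
import HarnessLib

/-!
# Cell `bsd-print-cf2` (leaf CornerF @ `p = 2`, row B14), prover p2 — the `2`-DESCENT-MATRIX ROAD, file 3/3: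
# the EVEN `ω = 3` atlas and the Li–Liu–Tian / Tian class-`5` doors of `B14 ∩ {j = 1728}` ON KERNEL `2`-DESCENT
# (Monsky's even formula and Rédei–Reichardt as TREE THEOREMS; displayed sets `{TYZ, GZK}` resp. `{LLT}` only)

HONEST FRAMING (cell `bsd-print-cf2`, HOME `run/shared/lean/pub/bsd-print-cf2/`; D-0131 (2) PRINT TIER;
PARTITION currency, D-0054 (2)). The leaf is `CornerF W 2 = HasCM ∧ analyticRank = 1` at `p = 2` (row B14 /
O12; `0` census cells, OPEN AS A CLASS). This file asserts NO arithmetic fact: every theorem is a kernel theorem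
MODULO the named journal facts in its binders. Files 1/3 and 2/3 of this series
(`CongruentNumberGenusDoorsKernelDescent.lean` p533042, `CongruentNumberGenusFamiliesKernelDescent.lean` p533057)
re-keyed the odd doors, the class-`6` door B6 and Tian's class-`6`/`7` families; the uniform even door and the
half-family `2·p₅·q`, `(p/q) = +1` were already re-keyed by cell `bsd-monsky`
(`P2/CongruentNumberPairsAtTwoEvenDoorDescent.lean`, `P2/CongruentNumberEvenFiveFamilyDescent.lean`). Here:
* §1 the EVEN `ω(m) = 3` atlas (`n = 2p₀p₁p₂ ≡ 6 (mod 8)`, `s(n) = 1`, configuration not silent):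
  `ord_{s=1} L = 1`, rank `1`, `Ш[2^∞] = 0`, `BSD(E_n, 2)` modulo `{hTYZ, hGZK}` — Monsky's EVEN matrix theorem
  (`hMe`, printed as a "sketch proof" in the appendix to Heath-Brown 1994, flag `HB94-even-sketch`) is the
  tree's `monsky_card_selmerGroup_two_even_holds`, Rédei–Reichardt is `redeiReichardt_fourTwoCard_classGroup_holds`;
* §2 the Li–Liu–Tian 2024 Thm 1.2 doors whose class-group hypothesis «`ℚ(√−n)` has no ideal class of order `4`»
  is decided in the kernel by a Rédei matrix — the per-`n` Rédei door (`…_of_redei_card_ker_descent`) and Tian's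
  class-`5` odd-graph family (`n = p₀⋯p_k ≡ 5 (mod 8)`, all `pᵢ ≡ 1 (mod 4)`, odd Legendre graph; uniformly in
  `k`) — now modulo `hLLT : LiLiuTian2024.thm12_bsd_congruentNumberCurve` ONLY (was `{hLLT, hR}`): FULL BSD
  (`BSD(E_n, ℓ)` for every prime `ℓ`, in particular `ℓ = 2`), `rank = r_an = 1`.
"Beyond-print theorem": NO (display minimisation on families already LITERAL-by-name; LLT 2024 Thm 1.2 is
the refereed print). Nothing booked; no mark moved; `0` census cells. Unit `bsd-print-cf2-p2` g0; NEW file.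

References: [TianYuanZhang2017] Thm 1.2, §3; [HeathBrown1994SelmerCongruentII] Appendix (Monsky) p. 41;
[LiLiuTian2024] Thm 1.2; [Tian2014] Thm 1.3, Lemma 5.1; [LiMa2008] Thm 0.4; [Miller2011LMS] Def 1.1.
-/

noncomputable section

open scoped Classical

open Matrix Finset WeierstrassCurve NumberField Literature.NumberTheory.EllipticCurves
  Literature.NumberTheory.EllipticCurves.LiLiuTian2024
  Literature.NumberTheory.EllipticCurves.Rank1Residual
  Literature.NumberTheory.EllipticCurves.Rank1Residual.Typed
  Literature.NumberTheory.EllipticCurves.Monsky1990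
  Literature.NumberTheory.EllipticCurves.HeathBrown1994
  Literature.NumberTheory.EllipticCurves.HeathBrown1994.Families
  Literature.NumberTheory.EllipticCurves.TianYuanZhang2017
  Literature.NumberTheory.EllipticCurves.Tian2014
  Literature.NumberTheory.EllipticCurves.FaulknerJames2007
  Literature.NumberTheory.QuadraticFields.RedeiReichardt

set_option autoImplicit false

namespace Summit.BirchSwinnertonDyer.Rank1Residual.P2

/-! ## §1 The even `ω(m) = 3` atlas on kernel descent -/

section EvenAtlas

/-- **DOOR B6 ON THE EVEN `ω(m) = 3` ATLAS, ON KERNEL DESCENT.** For distinct odd primes `p₀, p₁, p₂` with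
`n = 2p₀p₁p₂ ≡ 6 (mod 8)`, `s(n) = 1` (Monsky even rank) and a NON-silent configuration
(`silentEvenCfg … = false`): `ord_{s=1} L(E_n, s) = 1`, rank `1`, `Ш(E_n)[2^∞] = 0`, `BSD(E_n, 2)` — modulo
`hTYZ`, `hGZK` ONLY. [cite: TianYuanZhang2017, Thm. 1.2, Thm. 3.5 and §1 (1.1)]
[cite: HeathBrown1994SelmerCongruentII, Appendix (Monsky), typescript p. 41 L20–L36]
[cite: Miller2011LMS, Def. 1.1 (arXiv:1010.2431 p. 3)] -/
theorem rankOne_sha_bsdp_two_congruentNumberCurve_two_mul_three_of_not_silent_descent (p : Fin 3 → ℕ)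
    (hTYZ : tyz_genusPointData) (hGZK : rank_eq_analyticRank_of_analyticRank_le_one)
    (hp : ∀ i, (p i).Prime) (hinj : Function.Injective p) {n : ℕ} (hn : 2 * ∏ i, p i = n)
    (h8 : n % 8 = 6) (hs : monskySelmerRankEven p = 1)
    (hns : silentEvenCfg (fun i => p i % 8) (fun a b => kroneckerBit (p b) (p a)) = false) :
    (congruentNumberCurve n).analyticRank = 1 ∧ (congruentNumberCurve n).mordellWeilRank = 1 ∧
      AddCommGroup.primaryComponent (congruentNumberCurve n).sha 2 = ⊥ ∧
      BSDp (congruentNumberCurve n) 2 :=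
  rankOne_sha_bsdp_two_congruentNumberCurve_two_mul_three_of_not_silent p hTYZ hGZK
    monsky_card_selmerGroup_two_even_holds redeiReichardt_fourTwoCard_classGroup_holds hp hinj hn h8 hs hns

end EvenAtlas

/-! ## §2 The Li–Liu–Tian doors with the class-group hypothesis decided by a Rédei matrix, on kernel descent -/

section LLT

/-- **The per-`n` Rédei door for Li–Liu–Tian 2024 Thm 1.2, ON KERNEL DESCENT.** For `n = q₁⋯q_k ≡ 5 (mod 8)`
with distinct primes `qᵢ ≡ 1 (mod 4)` and a `2`-element kernel of the Rédei matrix of `ℚ(√−n)` on `(2, q₁, …, q_k)`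
(decidable; = «no ideal class of order `4`» by Rédei–Reichardt, a tree theorem): `BSD(E_n, ℓ)` for EVERY prime
`ℓ` — modulo `hLLT` ONLY (was `{hR, hLLT}`). [cite: LiLiuTian2024, Thm. 1.2] [cite: LiMa2008, Thm. 0.4 (p. 280)]
[cite: Miller2011LMS, §1 and Def. 1.1] -/
theorem forall_bsdp_congruentNumberCurve_of_redei_card_ker_descent {k : ℕ}
    (hLLT : thm12_bsd_congruentNumberCurve) (q : Fin k → ℕ) (hq : ∀ i, (q i).Prime)
    (hinj : Function.Injective q) (h1 : ∀ i, q i % 4 = 1) {n : ℕ} (hn : ∏ i, q i = n) (h8 : n % 8 = 5)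
    (hker : Fintype.card {v : Fin (k + 1) → ZMod 2 // redeiMatrix n (Matrix.vecCons 2 q) *ᵥ v = 0} = 2)
    (ℓ : ℕ) (hℓ : ℓ.Prime) : BSDp (congruentNumberCurve n) ℓ :=
  forall_bsdp_congruentNumberCurve_of_redei_card_ker redeiReichardt_fourTwoCard_classGroup_holds hLLT q hq hinj
    h1 hn h8 hker ℓ hℓ

/-- **The per-`n` Rédei door, rank and full BSD form, ON KERNEL DESCENT**: `rank E_n(ℚ) = 1 = ord_{s=1} L(E_n, s)`
and RANK ∧ SHAFIN ∧ LEAD, modulo `hLLT` only. [cite: LiLiuTian2024, Thm. 1.2] [cite: LiMa2008, Thm. 0.4 (p. 280)] -/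
theorem bsd_congruentNumberCurve_of_redei_card_ker_descent {k : ℕ}
    (hLLT : thm12_bsd_congruentNumberCurve) (q : Fin k → ℕ) (hq : ∀ i, (q i).Prime)
    (hinj : Function.Injective q) (h1 : ∀ i, q i % 4 = 1) {n : ℕ} (hn : ∏ i, q i = n) (h8 : n % 8 = 5)
    (hker : Fintype.card {v : Fin (k + 1) → ZMod 2 // redeiMatrix n (Matrix.vecCons 2 q) *ᵥ v = 0} = 2) :
    haveI := isElliptic_congruentNumberCurve (Squarefree.ne_zero (hn ▸ squarefree_prod_of_injective q hq hinj))
    haveI := isGloballyMinimal_congruentNumberCurve (hn ▸ squarefree_prod_of_injective q hq hinj)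
    (congruentNumberCurve n).mordellWeilRank = 1 ∧ (congruentNumberCurve n).analyticRank = 1 ∧
      (congruentNumberCurve n).BSDTriple :=
  bsd_congruentNumberCurve_of_redei_card_ker redeiReichardt_fourTwoCard_classGroup_holds hLLT q hq hinj h1 hn
    h8 hker

variable {k : ℕ} (p : Fin (k + 1) → ℕ)

/-- **TIAN'S CLASS-`5` FAMILY (= the odd-graph slice of Li–Liu–Tian's family), ON KERNEL DESCENT.** For
`n = p₀⋯p_k ≡ 5 (mod 8)` with distinct primes `pᵢ ≡ 1 (mod 4)` and odd Legendre graph (`hG`): `rank E_n(ℚ) = 1 =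
ord_{s=1} L(E_n, s)` and RANK ∧ SHAFIN ∧ LEAD — modulo `hLLT` ONLY (was `{hR, hLLT}`); the hypothesis «no ideal
class of order `4` in `ℚ(√−n)`» is the tree's `noIdealClassOfOrderFour_caseFive` on Rédei–Reichardt `_holds`.
[cite: LiLiuTian2024, Thm. 1.2] [cite: Tian2014, Thm. 1.3 and Lemma 5.1 (arXiv p. 2, p. 28)] [cite: LiMa2008, Thm. 0.4 (p. 280)] -/
theorem bsd_congruentNumberCurve_caseFive_descent (hLLT : thm12_bsd_congruentNumberCurve)
    (hp : ∀ i, (p i).Prime) (hinj : Function.Injective p) (h4 : ∀ i, p i % 4 = 1) (h5 : (∏ i, p i) % 8 = 5)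
    (hG : ∀ v, legendreMatrix p *ᵥ v = 0 → v = 0 ∨ v = fun _ => 1) {n : ℕ} (hn : ∏ i, p i = n) :
    haveI := isElliptic_congruentNumberCurve
      (Squarefree.ne_zero (Tian2014.thm12_hypotheses_caseFive p hp hinj h4 h5 hn).1)
    haveI := isGloballyMinimal_congruentNumberCurve (Tian2014.thm12_hypotheses_caseFive p hp hinj h4 h5 hn).1
    (congruentNumberCurve n).mordellWeilRank = 1 ∧ (congruentNumberCurve n).analyticRank = 1 ∧
      (congruentNumberCurve n).BSDTriple :=
  Tian2014.bsd_congruentNumberCurve_caseFive p redeiReichardt_fourTwoCard_classGroup_holds hLLT hp hinj h4 h5 hG hn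

/-- **`BSD(E_n, ℓ)` for EVERY prime `ℓ` on Tian's class-`5` family, ON KERNEL DESCENT** (in particular `ℓ = 2`:
the leaf's prime), modulo `hLLT` only, uniformly in `k`. [cite: LiLiuTian2024, Thm. 1.2]
[cite: Tian2014, Thm. 1.3 and Lemma 5.1] [cite: Miller2011LMS, §1 and Def. 1.1] -/
theorem forall_bsdp_congruentNumberCurve_caseFive_descent (hLLT : thm12_bsd_congruentNumberCurve)
    (hp : ∀ i, (p i).Prime) (hinj : Function.Injective p) (h4 : ∀ i, p i % 4 = 1) (h5 : (∏ i, p i) % 8 = 5)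
    (hG : ∀ v, legendreMatrix p *ᵥ v = 0 → v = 0 ∨ v = fun _ => 1) {n : ℕ} (hn : ∏ i, p i = n)
    (ℓ : ℕ) (hℓ : ℓ.Prime) :
    haveI := isElliptic_congruentNumberCurve
      (Squarefree.ne_zero (Tian2014.thm12_hypotheses_caseFive p hp hinj h4 h5 hn).1)
    haveI := isGloballyMinimal_congruentNumberCurve (Tian2014.thm12_hypotheses_caseFive p hp hinj h4 h5 hn).1
    BSDp (congruentNumberCurve n) ℓ :=
  Tian2014.forall_bsdp_congruentNumberCurve_caseFive p redeiReichardt_fourTwoCard_classGroup_holds hLLT hp hinj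
    h4 h5 hG hn ℓ hℓ

/-- **`BSD(E_n, 2)` on Tian's class-`5` family, quantified, ON KERNEL DESCENT** — modulo `hLLT` only; nothing
per-curve displayed. [cite: LiLiuTian2024, Thm. 1.2] [cite: Tian2014, Thm. 1.3 and Lemma 5.1]
[cite: Miller2011LMS, Def. 1.1] -/
theorem forall_bsdp_two_congruentNumberCurve_caseFive_descent (hLLT : thm12_bsd_congruentNumberCurve) :
    ∀ (k : ℕ) (p : Fin (k + 1) → ℕ), (∀ i, (p i).Prime) → Function.Injective p → (∀ i, p i % 4 = 1) →
      (∏ i, p i) % 8 = 5 → (∀ v, legendreMatrix p *ᵥ v = 0 → v = 0 ∨ v = fun _ => 1) →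
      BSDp (congruentNumberCurve (∏ i, p i)) 2 :=
  fun _ p hp hinj h4 h5 hG =>
    forall_bsdp_congruentNumberCurve_caseFive_descent p hLLT hp hinj h4 h5 hG rfl 2 Nat.prime_two

end LLT

end Summit.BirchSwinnertonDyer.Rank1Residual.P2

end
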